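import Literature.Analysis.SegalBargmann.HermiteSupNormGrowth
import HarnessLib

/-!
# Polynomial growth of the Schwartz seminorms of Hermite expansions (Reed–Simon I, Thm V.13; Folland 1989, §1.7)

Topic `Analysis/SegalBargmann`; namespace `Literature.Analysis.SegalBargmann`.  Continuation of
`Literature.Analysis.SegalBargmann.HermiteSupNormGrowth`.  For a finite Hermite sum `F ∈ V_d = span {h_β : |β| ≤ d}` on
`ℝ^σ` (`n = |σ|`) and every pair `(k, l)`, the Schwartz seminorm `p_{k,l}(F) = sup_x ‖x‖^k ‖D^l F(x)‖` (Mathlib's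
`SchwartzMap.seminorm ℂ k l`) is bounded by `C_{σ,k,l} (d+1)^{k+l+n+1} ‖F‖_{L²}`:

* §1 the operator norm of an `l`-linear map on `ℝ^σ` is at most the sum of its values on coordinate tuples
  (`norm_le_sum_norm_apply_single`), so `‖D^l F(x)‖ ≤ Σ_{J ∈ σ^l} ‖∂_J F(x)‖` (iterated coordinate derivatives, Mathlib
  `LineDeriv.iteratedLineDerivOp`);
* §2 `∂_j = 2πi D_j : V_d → V_{d+1}` with `∫‖∂_j F‖² ≤ 4π(d+1) ∫‖F‖²`, hence `∂_J : V_d → V_{d+l}` with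
  `∫ ‖∂_J F‖² ≤ (4π(d+l))^l ∫ ‖F‖²`;
* §3 with `‖x‖^k ≤ (1+‖x‖²)^k`, the weighted-`L²` bound for `(1+|x|²)^k` and the sup-norm bound on `V_{d+l+2k}`
  (`HermiteSupNormGrowth`): `p_{k,l}(F) ≤ C (d+1)^{k+l+n+1} ‖F‖_{L²}` (`exists_seminorm_le_of_isHermiteSum`) and
  `p_{k,l}(h_α) ≤ C (|α|+1)^{k+l+n+1}` (`exists_seminorm_hermiteSchwartz_herm_le`).

This is the estimate that makes `(c_α) ↦ Σ_α c_α h_α` continuous from rapidly decreasing multi-sequences into `𝒮(ℝⁿ)`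
(the `N`-representation theorem for `𝒮`, Reed–Simon I Thm V.13).  Everything is proved from Mathlib and the imported
tree files; no cited fact is used as a hypothesis.

## References

* M. Reed, B. Simon, *Methods of Modern Mathematical Physics I*, Theorem V.13 and the Appendix to §V.3.
* G. B. Folland, *Harmonic Analysis in Phase Space*, Annals of Mathematics Studies 122, Princeton UP (1989), §1.7.
  [cite: Folland1989, §1.7]

## Provenance

Written for the tree under the LEAN-IN-TREE rule (2026-08-18) by the pub-hodgecm formalisation cell (model-construction
sub-cell, seat mc-binder-2).
-/

set_option autoImplicit false

noncomputable section

open MvPolynomial Complex SchwartzMap MeasureTheory LineDeriv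
open scoped BigOperators Real LineDeriv

namespace Literature.Analysis.SegalBargmann

variable {σ : Type*} [Fintype σ] [DecidableEq σ]

/-! ## §1  Multilinear maps on `ℝ^σ` are controlled by their values on coordinate tuples -/

section Multilinear

/-- **`‖A‖ ≤ Σ_{J ∈ σ^l} ‖A(e_{J 1}, …, e_{J l})‖`** for a continuous `l`-linear map on `ℝ^σ` (expand each argument in
the standard basis; `|v_j| ≤ ‖v‖`). [folklore] -/
theorem norm_le_sum_norm_apply_single {l : ℕ} {G : Type*} [NormedAddCommGroup G] [NormedSpace ℝ G]
    (A : ContinuousMultilinearMap ℝ (fun _ : Fin l => EuclideanSpace ℝ σ) G) :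
    ‖A‖ ≤ ∑ J : Fin l → σ, ‖A fun i => EuclideanSpace.single (J i) (1 : ℝ)‖ := by
  refine ContinuousMultilinearMap.opNorm_le_bound (Finset.sum_nonneg fun J _ => norm_nonneg _) fun v => ?_
  have hv : v = fun i => ∑ j : σ, (v i j) • EuclideanSpace.single j (1 : ℝ) := by
    funext i
    conv_lhs => rw [← (EuclideanSpace.basisFun σ ℝ).sum_repr (v i)]
    simp only [EuclideanSpace.basisFun_repr, EuclideanSpace.basisFun_apply]
  have hexp : A v = ∑ J : Fin l → σ, (∏ i, v i (J i)) • A fun i => EuclideanSpace.single (J i) (1 : ℝ) := by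
    conv_lhs => rw [hv]
    rw [ContinuousMultilinearMap.map_sum]
    refine Finset.sum_congr rfl fun J _ => ?_
    exact A.map_smul_univ (fun i => v i (J i)) fun i => EuclideanSpace.single (J i) (1 : ℝ)
  rw [hexp, Finset.sum_mul]
  refine (norm_sum_le _ _).trans (Finset.sum_le_sum fun J _ => ?_)
  rw [norm_smul, norm_prod, mul_comm]
  refine mul_le_mul_of_nonneg_left (Finset.prod_le_prod (fun i _ => norm_nonneg _) fun i _ => ?_) (norm_nonneg _)
  exact PiLp.norm_apply_le (v i) (J i)

/-- **`‖D^l f(x)‖ ≤ Σ_{J ∈ σ^l} ‖∂_J f(x)‖`**: the `l`-th Fréchet derivative of a Schwartz function is controlled by its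
iterated coordinate derivatives (Mathlib `iteratedLineDerivOp_eq_iteratedFDeriv`). [folklore] -/
theorem norm_iteratedFDeriv_le_sum (l : ℕ) (f : 𝓢(EuclideanSpace ℝ σ, ℂ)) (x : EuclideanSpace ℝ σ) :
    ‖iteratedFDeriv ℝ l f x‖ ≤
      ∑ J : Fin l → σ, ‖(∂^{fun i => EuclideanSpace.single (J i) (1 : ℝ)} f) x‖ := by
  refine (norm_le_sum_norm_apply_single _).trans (le_of_eq (Finset.sum_congr rfl fun J _ => ?_))
  rw [iteratedLineDerivOp_eq_iteratedFDeriv]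

end Multilinear

/-! ## §2  Coordinate derivatives on `V_d` -/

section Derivatives

variable {F : 𝓢(EuclideanSpace ℝ σ, ℂ)}

/-- `∂_j = 2πi · D_j` (`D_j = (2πi)⁻¹ ∂_j`, `HermiteOscillator.opDCLM`). [folklore] -/
theorem lineDerivOp_single_eq_smul_opDCLM (j : σ) (f : 𝓢(EuclideanSpace ℝ σ, ℂ)) :
    ∂_{EuclideanSpace.single j (1 : ℝ)} f = (2 * π * I : ℂ) • opDCLM j f := by
  have h2 : (2 * π * I : ℂ) ≠ 0 := mul_ne_zero (mul_ne_zero two_ne_zero (Complex.ofReal_ne_zero.mpr Real.pi_ne_zero))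
    Complex.I_ne_zero
  rw [opDCLM_eq_smul, smul_smul, mul_inv_cancel₀ h2, one_smul]

/-- **`∂_j : V_d → V_{d+1}`**. [cite: Folland1989, (1.82)] -/
theorem IsHermiteSum.map_lineDerivOp_degLE {d : ℕ} (j : σ) (hF : IsHermiteSum (degLE d) F) :
    IsHermiteSum (degLE (d + 1)) (∂_{EuclideanSpace.single j (1 : ℝ)} F) := by
  rw [lineDerivOp_single_eq_smul_opDCLM]
  exact (hF.map_opDCLM_degLE j).smul _

/-- **`∫ ‖∂_j F‖² ≤ 4π(d+1) ∫ ‖F‖²` on `V_d`**. [cite: Folland1989, §1.7] -/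
theorem IsHermiteSum.integral_norm_sq_lineDerivOp_le {d : ℕ} (j : σ) (hF : IsHermiteSum (degLE d) F) :
    ∫ x : EuclideanSpace ℝ σ, ‖(∂_{EuclideanSpace.single j (1 : ℝ)} F) x‖ ^ 2 ≤
      (4 * π * ((d : ℝ) + 1)) * ∫ x : EuclideanSpace ℝ σ, ‖F x‖ ^ 2 := by
  have hnorm : ‖(2 * π * I : ℂ)‖ = 2 * π := by
    rw [norm_mul, norm_mul, Complex.norm_ofNat, Complex.norm_real, Complex.norm_I, mul_one,
      Real.norm_of_nonneg Real.pi_pos.le]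
  rw [lineDerivOp_single_eq_smul_opDCLM, integral_norm_sq_smul, hnorm]
  have h := hF.integral_norm_sq_opDCLM_le_degLE j
  have h0 : 0 ≤ ∫ x : EuclideanSpace ℝ σ, ‖F x‖ ^ 2 := integral_nonneg fun _ => by positivity
  calc (2 * π) ^ 2 * ∫ x : EuclideanSpace ℝ σ, ‖opDCLM j F x‖ ^ 2
      ≤ (2 * π) ^ 2 * ((((d : ℝ) + 1) / π) * ∫ x : EuclideanSpace ℝ σ, ‖F x‖ ^ 2) := by gcongr
    _ = (4 * π * ((d : ℝ) + 1)) * ∫ x : EuclideanSpace ℝ σ, ‖F x‖ ^ 2 := by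
        field_simp
        ring

/-- **`∂_J : V_d → V_{d+l}`** for an `l`-tuple of coordinate directions `J`. [cite: Folland1989, (1.82)] -/
theorem IsHermiteSum.map_iteratedLineDerivOp_degLE {d l : ℕ} (J : Fin l → σ) (hF : IsHermiteSum (degLE d) F) :
    IsHermiteSum (degLE (d + l)) (∂^{fun i => EuclideanSpace.single (J i) (1 : ℝ)} F) := by
  induction l with
  | zero => simpa [iteratedLineDerivOp_fin_zero] using hF
  | succ l ih =>
      rw [iteratedLineDerivOp_succ_left, show d + (l + 1) = d + l + 1 by ring]
      exact (ih (Fin.tail J)).map_lineDerivOp_degLE (J 0)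

/-- **`∫ ‖∂_J F‖² ≤ (4π(d+l))^l ∫ ‖F‖²` on `V_d`** for an `l`-tuple of coordinate directions `J`.
[cite: Folland1989, §1.7] -/
theorem IsHermiteSum.integral_norm_sq_iteratedLineDerivOp_le {d l : ℕ} (J : Fin l → σ)
    (hF : IsHermiteSum (degLE d) F) :
    ∫ x : EuclideanSpace ℝ σ, ‖(∂^{fun i => EuclideanSpace.single (J i) (1 : ℝ)} F) x‖ ^ 2 ≤
      (4 * π * ((d : ℝ) + l)) ^ l * ∫ x : EuclideanSpace ℝ σ, ‖F x‖ ^ 2 := by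
  have h0 : 0 ≤ ∫ x : EuclideanSpace ℝ σ, ‖F x‖ ^ 2 := integral_nonneg fun _ => by positivity
  induction l with
  | zero => simp [iteratedLineDerivOp_fin_zero]
  | succ l ih =>
      rw [iteratedLineDerivOp_succ_left]
      have hG := hF.map_iteratedLineDerivOp_degLE (Fin.tail J)
      refine (hG.integral_norm_sq_lineDerivOp_le (J 0)).trans ?_
      have ih' := ih (Fin.tail J)
      push_cast at ih' ⊢
      have hmono : (4 * π * ((d : ℝ) + l)) ^ l ≤ (4 * π * ((d : ℝ) + (l + 1))) ^ l :=
        pow_le_pow_left₀ (by positivity) (by nlinarith [Real.pi_pos]) l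
      calc 4 * π * ((d : ℝ) + l + 1) *
            ∫ x : EuclideanSpace ℝ σ, ‖(∂^{fun i => EuclideanSpace.single (Fin.tail J i) (1 : ℝ)} F) x‖ ^ 2
          ≤ 4 * π * ((d : ℝ) + l + 1) * ((4 * π * ((d : ℝ) + l)) ^ l * ∫ x : EuclideanSpace ℝ σ, ‖F x‖ ^ 2) := by
            gcongr
        _ ≤ 4 * π * ((d : ℝ) + (l + 1)) *
              ((4 * π * ((d : ℝ) + (l + 1))) ^ l * ∫ x : EuclideanSpace ℝ σ, ‖F x‖ ^ 2) := by
            rw [add_assoc]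
            gcongr
        _ = (4 * π * ((d : ℝ) + (l + 1))) ^ (l + 1) * ∫ x : EuclideanSpace ℝ σ, ‖F x‖ ^ 2 := by ring

end Derivatives

/-! ## §3  The Schwartz seminorms on `V_d` -/

section Seminorm

variable {F : 𝓢(EuclideanSpace ℝ σ, ℂ)}

omit [Fintype σ] [DecidableEq σ] in
/-- `‖x‖^k ≤ (1 + ‖x‖²)^k`. [folklore] -/
theorem norm_pow_le_one_add_norm_sq_pow {E : Type*} [SeminormedAddCommGroup E] (x : E) (k : ℕ) :
    ‖x‖ ^ k ≤ (1 + ‖x‖ ^ 2) ^ k :=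
  pow_le_pow_left₀ (norm_nonneg x) (by nlinarith [norm_nonneg x, sq_nonneg (‖x‖ - 1)]) k

omit [DecidableEq σ] in
/-- `‖x‖^k ‖G(x)‖ ≤ ‖((1+|x|²)^k G)(x)‖`. [folklore] -/
theorem norm_pow_mul_norm_apply_le (k : ℕ) (G : 𝓢(EuclideanSpace ℝ σ, ℂ)) (x : EuclideanSpace ℝ σ) :
    ‖x‖ ^ k * ‖G x‖ ≤ ‖(oneAddNormSqCLM ^ k) G x‖ := by
  have hpos : (0 : ℝ) ≤ 1 + ‖x‖ ^ 2 := by positivity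
  rw [oneAddNormSqCLM_pow_apply, norm_mul, Complex.norm_real, Real.norm_of_nonneg (pow_nonneg hpos k)]
  exact mul_le_mul_of_nonneg_right (norm_pow_le_one_add_norm_sq_pow x k) (norm_nonneg _)

/-- **Schwartz-seminorm growth on `V_d`, raw form**: with `C₀` the sup-norm constant of
`exists_norm_apply_le_of_isHermiteSum`, for `F ∈ V_d` and every `x`,
`‖x‖^k ‖D^l F(x)‖ ≤ n^l · C₀ (d+l+2k+1)^{n+1} · √((2+2n²(d+l+2k)²)^k (4π(d+l))^l ∫‖F‖²)`. [cite: Folland1989, §1.7] -/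
theorem IsHermiteSum.norm_pow_mul_norm_iteratedFDeriv_le {C₀ : ℝ} (hC₀ : 0 ≤ C₀)
    (hsup : ∀ (d : ℕ) (G : 𝓢(EuclideanSpace ℝ σ, ℂ)), IsHermiteSum (degLE d) G →
      ∀ x : EuclideanSpace ℝ σ, ‖G x‖ ≤ C₀ * ((d : ℝ) + 1) ^ (Fintype.card σ + 1) *
        Real.sqrt (∫ y : EuclideanSpace ℝ σ, ‖G y‖ ^ 2))
    {d : ℕ} (hF : IsHermiteSum (degLE d) F) (k l : ℕ) (x : EuclideanSpace ℝ σ) :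
    ‖x‖ ^ k * ‖iteratedFDeriv ℝ l F x‖ ≤
      (Fintype.card σ : ℝ) ^ l * (C₀ * ((d : ℝ) + l + 2 * k + 1) ^ (Fintype.card σ + 1) *
        Real.sqrt ((2 + 2 * (Fintype.card σ : ℝ) ^ 2 * ((d : ℝ) + l + 2 * k) ^ 2) ^ k *
          ((4 * π * ((d : ℝ) + l)) ^ l * ∫ y : EuclideanSpace ℝ σ, ‖F y‖ ^ 2))) := by
  set n : ℕ := Fintype.card σ with hn
  set B : ℝ := C₀ * ((d : ℝ) + l + 2 * k + 1) ^ (n + 1) *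
    Real.sqrt ((2 + 2 * (n : ℝ) ^ 2 * ((d : ℝ) + l + 2 * k) ^ 2) ^ k *
      ((4 * π * ((d : ℝ) + l)) ^ l * ∫ y : EuclideanSpace ℝ σ, ‖F y‖ ^ 2)) with hB
  -- each coordinate term is bounded by `B`
  have hJ : ∀ J : Fin l → σ,
      ‖x‖ ^ k * ‖(∂^{fun i => EuclideanSpace.single (J i) (1 : ℝ)} F) x‖ ≤ B := fun J => by
    set G := ∂^{fun i => EuclideanSpace.single (J i) (1 : ℝ)} F with hGdef
    have hG : IsHermiteSum (degLE (d + l)) G := hF.map_iteratedLineDerivOp_degLE J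
    have hGint := hF.integral_norm_sq_iteratedLineDerivOp_le J
    have hWG : IsHermiteSum (degLE (d + l + 2 * k)) ((oneAddNormSqCLM ^ k) G) := hG.map_oneAddNormSqCLM_pow_degLE k
    have hWGint := hG.integral_norm_sq_oneAddNormSqCLM_pow_le k
    have hsupW := hsup (d + l + 2 * k) ((oneAddNormSqCLM ^ k) G) hWG x
    simp only [Nat.cast_add, Nat.cast_mul, Nat.cast_ofNat] at hWGint hsupW
    refine (norm_pow_mul_norm_apply_le k G x).trans (hsupW.trans ?_)
    rw [hB]
    refine mul_le_mul_of_nonneg_left (Real.sqrt_le_sqrt (hWGint.trans ?_)) (by positivity)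
    exact mul_le_mul_of_nonneg_left hGint (by positivity)
  calc ‖x‖ ^ k * ‖iteratedFDeriv ℝ l F x‖
      ≤ ‖x‖ ^ k * ∑ J : Fin l → σ, ‖(∂^{fun i => EuclideanSpace.single (J i) (1 : ℝ)} F) x‖ :=
        mul_le_mul_of_nonneg_left (norm_iteratedFDeriv_le_sum l F x) (by positivity)
    _ = ∑ J : Fin l → σ, ‖x‖ ^ k * ‖(∂^{fun i => EuclideanSpace.single (J i) (1 : ℝ)} F) x‖ := Finset.mul_sum _ _ _
    _ ≤ ∑ _J : Fin l → σ, B := Finset.sum_le_sum fun J _ => hJ J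
    _ = (n : ℝ) ^ l * B := by
        rw [Finset.sum_const, Finset.card_univ, Fintype.card_fun, Fintype.card_fin, nsmul_eq_mul, Nat.cast_pow]

/-- **Polynomial growth of the Schwartz seminorms on `V_d`**: for every `k, l` there is `C = C_{σ,k,l} ≥ 0` with
`p_{k,l}(F) ≤ C (d+1)^{k+l+n+1} ‖F‖_{L²}` for all `d` and all `F ∈ V_d = span {h_β : |β| ≤ d}` (`n = |σ|`,
`p_{k,l} = SchwartzMap.seminorm ℂ k l`). [cite: Folland1989, §1.7] -/
theorem exists_seminorm_le_of_isHermiteSum (k l : ℕ) :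
    ∃ C : ℝ, 0 ≤ C ∧ ∀ (d : ℕ) (F : 𝓢(EuclideanSpace ℝ σ, ℂ)), IsHermiteSum (degLE d) F →
      SchwartzMap.seminorm ℂ k l F ≤
        C * ((d : ℝ) + 1) ^ (k + l + Fintype.card σ + 1) * Real.sqrt (∫ y : EuclideanSpace ℝ σ, ‖F y‖ ^ 2) := by
  obtain ⟨C₀, hC₀, hsup⟩ := exists_norm_apply_le_of_isHermiteSum (σ := σ)
  set n : ℕ := Fintype.card σ with hn
  -- `D := d + l + 2k + 1 ≤ (l + 2k + 1)(d + 1)`; all factors are bounded by powers of `D`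
  set c₁ : ℝ := 2 + 2 * (n : ℝ) ^ 2 with hc₁
  set A : ℝ := (l : ℝ) + 2 * k + 1 with hA
  refine ⟨(n : ℝ) ^ l * C₀ * Real.sqrt (c₁ ^ k * (4 * π) ^ l) * A ^ (k + l + n + 1), by positivity,
    fun d F hF => ?_⟩
  have hI0 : 0 ≤ ∫ y : EuclideanSpace ℝ σ, ‖F y‖ ^ 2 := integral_nonneg fun _ => by positivity
  refine SchwartzMap.seminorm_le_bound ℂ k l F (by positivity) fun x => ?_
  refine (hF.norm_pow_mul_norm_iteratedFDeriv_le hC₀ hsup k l x).trans ?_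
  rw [← hn]
  set D : ℝ := (d : ℝ) + l + 2 * k + 1 with hD
  have hD1 : 1 ≤ D := by rw [hD]; linarith [(by positivity : (0 : ℝ) ≤ (d : ℝ) + l + 2 * k)]
  have hD0 : 0 ≤ D := zero_le_one.trans hD1
  -- the three factors under control
  have h1 : 2 + 2 * (n : ℝ) ^ 2 * ((d : ℝ) + l + 2 * k) ^ 2 ≤ c₁ * D ^ 2 := by
    rw [hc₁, hD]
    have : ((d : ℝ) + l + 2 * k) ^ 2 ≤ ((d : ℝ) + l + 2 * k + 1) ^ 2 := by
      nlinarith [(by positivity : (0 : ℝ) ≤ (d : ℝ) + l + 2 * k)]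
    nlinarith [mul_le_mul_of_nonneg_left this (by positivity : (0 : ℝ) ≤ 2 * (n : ℝ) ^ 2),
      (by positivity : (0 : ℝ) ≤ (n : ℝ) ^ 2)]
  have h2 : 4 * π * ((d : ℝ) + l) ≤ 4 * π * D ^ 2 := by
    have : (d : ℝ) + l ≤ D ^ 2 := by rw [hD]; nlinarith [(by positivity : (0 : ℝ) ≤ (d : ℝ) + l), hD1]
    exact mul_le_mul_of_nonneg_left this (by positivity)
  have h3 : (2 + 2 * (n : ℝ) ^ 2 * ((d : ℝ) + l + 2 * k) ^ 2) ^ k * ((4 * π * ((d : ℝ) + l)) ^ l *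
      ∫ y : EuclideanSpace ℝ σ, ‖F y‖ ^ 2) ≤ (c₁ ^ k * (4 * π) ^ l) * (D ^ (k + l)) ^ 2 *
        ∫ y : EuclideanSpace ℝ σ, ‖F y‖ ^ 2 := by
    calc (2 + 2 * (n : ℝ) ^ 2 * ((d : ℝ) + l + 2 * k) ^ 2) ^ k * ((4 * π * ((d : ℝ) + l)) ^ l *
          ∫ y : EuclideanSpace ℝ σ, ‖F y‖ ^ 2)
        ≤ (c₁ * D ^ 2) ^ k * ((4 * π * D ^ 2) ^ l * ∫ y : EuclideanSpace ℝ σ, ‖F y‖ ^ 2) := by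
          gcongr
      _ = (c₁ ^ k * (4 * π) ^ l) * (D ^ (k + l)) ^ 2 * ∫ y : EuclideanSpace ℝ σ, ‖F y‖ ^ 2 := by ring
  have h4 : Real.sqrt ((2 + 2 * (n : ℝ) ^ 2 * ((d : ℝ) + l + 2 * k) ^ 2) ^ k * ((4 * π * ((d : ℝ) + l)) ^ l *
      ∫ y : EuclideanSpace ℝ σ, ‖F y‖ ^ 2)) ≤ Real.sqrt (c₁ ^ k * (4 * π) ^ l) * D ^ (k + l) *
        Real.sqrt (∫ y : EuclideanSpace ℝ σ, ‖F y‖ ^ 2) := by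
    refine (Real.sqrt_le_sqrt h3).trans (le_of_eq ?_)
    rw [Real.sqrt_mul (by positivity), Real.sqrt_mul (by positivity), Real.sqrt_sq (by positivity)]
  have hDA : D ≤ A * ((d : ℝ) + 1) := by
    rw [hD, hA]
    nlinarith [(Nat.cast_nonneg d : (0 : ℝ) ≤ d), (Nat.cast_nonneg l : (0 : ℝ) ≤ l),
      (Nat.cast_nonneg k : (0 : ℝ) ≤ k)]
  calc (n : ℝ) ^ l * (C₀ * D ^ (n + 1) * Real.sqrt ((2 + 2 * (n : ℝ) ^ 2 * ((d : ℝ) + l + 2 * k) ^ 2) ^ k *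
        ((4 * π * ((d : ℝ) + l)) ^ l * ∫ y : EuclideanSpace ℝ σ, ‖F y‖ ^ 2)))
      ≤ (n : ℝ) ^ l * (C₀ * D ^ (n + 1) * (Real.sqrt (c₁ ^ k * (4 * π) ^ l) * D ^ (k + l) *
          Real.sqrt (∫ y : EuclideanSpace ℝ σ, ‖F y‖ ^ 2))) := by
        gcongr
    _ = (n : ℝ) ^ l * C₀ * Real.sqrt (c₁ ^ k * (4 * π) ^ l) * D ^ (k + l + n + 1) *
          Real.sqrt (∫ y : EuclideanSpace ℝ σ, ‖F y‖ ^ 2) := by ring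
    _ ≤ (n : ℝ) ^ l * C₀ * Real.sqrt (c₁ ^ k * (4 * π) ^ l) * (A * ((d : ℝ) + 1)) ^ (k + l + n + 1) *
          Real.sqrt (∫ y : EuclideanSpace ℝ σ, ‖F y‖ ^ 2) := by
        gcongr
    _ = (n : ℝ) ^ l * C₀ * Real.sqrt (c₁ ^ k * (4 * π) ^ l) * A ^ (k + l + n + 1) *
          ((d : ℝ) + 1) ^ (k + l + n + 1) * Real.sqrt (∫ y : EuclideanSpace ℝ σ, ‖F y‖ ^ 2) := by
        rw [mul_pow A ((d : ℝ) + 1) (k + l + n + 1)]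
        ring

/-- **Polynomial growth of the Schwartz seminorms of the Hermite functions**: for every `k, l` there is
`C = C_{σ,k,l} ≥ 0` with `p_{k,l}(h_α) ≤ C (|α| + 1)^{k+l+n+1}` for every multi-index `α` (`n = |σ|`).
[cite: Folland1989, §1.7] -/
theorem exists_seminorm_hermiteSchwartz_herm_le (k l : ℕ) :
    ∃ C : ℝ, 0 ≤ C ∧ ∀ α : σ →₀ ℕ,
      SchwartzMap.seminorm ℂ k l (hermiteSchwartz (herm α)) ≤
        C * ((α.degree : ℝ) + 1) ^ (k + l + Fintype.card σ + 1) := by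
  obtain ⟨C, hC0, hC⟩ := exists_seminorm_le_of_isHermiteSum (σ := σ) k l
  refine ⟨C, hC0, fun α => ?_⟩
  have h := hC α.degree (hermiteSchwartz (herm α)) (isHermiteSum_herm_degLE α)
  rwa [integral_norm_sq_hermiteSchwartz_herm, Real.sqrt_one, mul_one] at h

end Seminorm

end Literature.Analysis.SegalBargmann

end
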